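import Summits.CriticalPhenomena.Ising3DConformalLimit.Theses.ModularQuarterTurn
import HarnessLib

/-!
# Birth skeleton (BC3) — crux `WedgeModularRotation` (item stmt-CriticalPhenomena-6493),
# route `ModularQuarterTurn`, sub-problem `Ising3DConformalLimit`

Registrar: `planner-skel-stmt-CriticalPhenomena-6493-0` (skeleton-register, 2026-08-17); published as
`Cruxes/WedgeModularRotation/Lines/birth.lean` and registered with `ledger skeleton check`.

## The crux (verbatim, route decl `Theses.ModularQuarterTurn.WedgeModularRotation`, rank 2, spine)

Lattice Bisognano–Wichmann for the critical `ℤ³` Ising model: for every renormalisation `ρ > 0` on `(0,1]`,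
`Δ > 0` and family `S` with `ρ(δ)^n⟨∏σ_{[x_i/δ]}⟩⁺_{β_c} → S` locally uniformly off diagonals, `S`
normalised, non-degenerate, translation invariant and scale covariant, there is a box growth `L : ℝ → ℕ`
such that for every `n` the angle-interpolated words `ρ(δ)^n · Tr(∏_i G_i · B^{φ_i/2π})` of the box
`{−L(δ),…,L(δ)}³` (`B` = the hinge-pinned half-plane Gram kernel `Σ_η √(Pr Pr')`, PSD of trace one;
`G_i` = the spin at the half-plane site `(⌊r_i/δ⌋,0,⌊z_i/δ⌋)`; gaps `φ_i ≥ 0`, `Σφ_i = 2π`) converge to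
`S n ((r_i cos θ_i, r_i sin θ_i, z_i))_i`, `θ_i = c + Σ_{j<i} φ_j`, locally uniformly in `(c, (φ_i,r_i,z_i)_i)`
on the wedge domain. The word does not contain the offset `c`.

## Shape of this skeleton: existence / identification / isotropy (3 registered stubs)

The conclusion is a joint statement about (α) the LATTICE side — the modular words have a scaling limit
and that limit is the geometrically continued correlator at offset `0` — and (β) the CONTINUUM side — the
limit `S` is invariant under rotations about the hinge axis (this is what makes the `c`-free word converge
to the `c`-dependent target for every `c`; the route's `closes` extracts exactly this and feeds
`AxialRotationUpgrade`). We cut along these seams, the classical "tightness + identification of the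
limit + symmetry of the limit" partition:

* `stub_modularWordsConverge` (E, EXISTENCE of the modular scaling limit; open, L–XL): for every
  threshold `L₀` there is a box growth `L ≥ L₀` such that for every `n` the renormalised interpolated
  words converge locally uniformly on the offset-free wedge domain to SOME function `T`. Content:
  thermodynamic limit of fractional-power words at fixed mesh (route plan W1), equicontinuity in the
  angles (free from PSD: the word is a finite positive combination of `∏ λ^{s_i}`) and in the positions,
  and convergence along the full filter `δ → 0⁺` (not subsequences). No geometry is claimed.
* `stub_modularLimitIsGeometric` (I, IDENTIFICATION = lattice BW proper; open, XL, THE HEART): there is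
  `L₀` such that for every `L ≥ L₀`, every `n` and every candidate limit `T` of the words of the boxes
  `Λ_{L(δ)}`, `T` agrees on the wedge domain with `p ↦ S n ((r_i cos Σ_{j<i}φ_j, r_i sin Σ_{j<i}φ_j, z_i))_i`
  (offset `c = 0`). `L₀` must force `δ·L₀(δ) → ∞` (finite macroscopic boxes converge to the finite-box
  limit, not to `S`: `n = 1` already shows it), exactly as in the proved support item
  `FiniteVolumeScalingLimit`. Anchors: at `φ_i ∈ (π/2)ℕ` the word IS a box correlator of lattice-rotated
  spins (`QuarterTurnAnchors`, proved) and converges to `S` there (`FiniteVolumeScalingLimit`, proved,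
  plus translation invariance for the `⌊−t⌋ = −⌊t⌋−1` offsets); between anchors it is the convergence of
  the lattice modular flow to the geometric one (Bisognano–Wichmann form of `−log B` near the hinge).
* `stub_axialIsotropy` (A, SYMMETRY of the limit; open, L): on the wedge domain
  `S n (cyl(c,p)) = S n (cyl(0,p))` for every offset `c` — invariance of `S` under rotations about the
  hinge (`x₂`-) axis for angle-sorted configurations off the axis. It follows (M-sized, not done here)
  from E ∧ I by cyclicity of the trace (`Tr(G₀B^{s₀}G₁B^{s₁}⋯) = Tr(G₁B^{s₁}⋯G₀B^{s₀})` reads the same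
  word as the configuration rotated by `−φ₀`) plus permutation symmetry of `S`, and independently from
  `IsRotationInvariant S` (crux `LimitRotationInvariant` of route HyperoctahedralRP) by writing the axial
  rotation as an element of `O(3)`; it is kept as a named stub because it is separately attackable and is
  literally the hypothesis shape consumed by `AxialRotationUpgrade` in the route's `closes`.
* `WedgeModularRotation_of_parts : E → I → A → (crux, verbatim body)` — PROVED here (uniqueness-free
  glue: `congr_right` with I, `comp` with the projection `(c,p) ↦ p`, `congr_right` with A).
* `WedgeModularRotation_of : Theses.ModularQuarterTurn.WedgeModularRotation` — concludes the crux BY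
  NAME from the three stubs through `_of_parts` (A12 shape read by `ledger skeleton check`); `sorry`
  occurs only inside the three `stub_*`.

Disproof.lean for this crux: none exists yet (no `_false_without_` theorem to honour; `ledger crux ls`
showed no workfiles on 2026-08-17). Negatives index of the summit (`ledger negatives`, 2026-08-17): 11 refuted
statements (CardyFormulaZ2 4, PercolationContinuityZ3 3, SAWScalingLimit 4), none in this sub-problem; no stub
restates any of them. Dead lines: none recorded.

BC3 probes (registrar, farm, `maxHeartbeats 400000`, 2026-08-17): for each stub signature `X`,
`example : X → Theses.ModularQuarterTurn.WedgeModularRotation` and `example : X → Ising3DConformalLimit` by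
`first | exact? | simpa | aesop` — all 6 FAIL (rc 1, heartbeat exhaustion inside the combinator); split per
tactic (18 examples) — `exact?`: "could not close the goal" (6/6), `simpa`: "Tactic `assumption` failed"
(6/6), `aesop`: "failed to prove the goal after exhaustive search" (stub A, 2/2) / heartbeat exhaustion
(stubs E, I, 4/4). No stub is cheaply the crux or the summit. Files: the registrar's `bc/probe_*.lean`.
-/

namespace Summit.CriticalPhenomena.Ising3DConformalLimit.Cruxes.WedgeModularRotation.Birth

open scoped BigOperators Topology Manifold Classical MeasureTheory ProbabilityTheory Matrix InnerProductSpace ComplexConjugate ContinuousMap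
open Filter Set Function TopologicalSpace MeasureTheory
open Literature.Probability.LatticeModels

/-! ### The three registered stubs -/

/-- **Stub E — existence of the modular scaling limit** (`stub_modularWordsConverge`). Under the crux's
hypotheses on `(ρ, Δ, S)`: for every threshold `L₀ : ℝ → ℕ` there is a box growth `L ≥ L₀` such that for
every `n` the renormalised angle-interpolated words `ρ(δ)^n · Tr(∏_i G_i · B^{φ_i/2π})` of the boxes
`Λ_{L(δ)}` (same `P, E, Pr, B, G` as in the crux, insertion data `p = (φ_i, r_i, z_i)_i`) converge, as
`δ → 0⁺`, locally uniformly on the offset-free wedge domain, to some function `T`. Why plausibly true: at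
fixed mesh the words have a thermodynamic limit (modular theory of the half-plane algebra in the
transfer-matrix vacuum; finite-volume KMS functions converge), they are bounded and equi-Hölder in the
angles by positivity of `B` (Hadamard three-lines on `s ↦ Tr(X B^s Y B^{1-s})`), and a scaling limit of
the bulk correlators exists by hypothesis; the open part is compactness in the positions and uniqueness of
the limit along the full filter. Why it might fail: entanglement-spectrum (CTM) level spacing `∝ 1/log L`
could produce words with several subsequential limits. Size: L–XL (open). Leans on: `cfc` (Mathlib CFC for
real matrices), `isingExpect`, `box`, `criticalBeta`; refs Baxter1976, PeschelKaulkeLegeza1999,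
BisognanoWichmann1976. -/
theorem stub_modularWordsConverge :
    ∀ (ρ : ℝ → ℝ) (Δ : ℝ) (S : CorrFamily 3), (∀ δ ∈ Set.Ioc (0:ℝ) 1, 0 < ρ δ) → 0 < Δ → HasPointwiseScalingLimit (criticalCorr 3) ρ S → (∀ n z, z ∉ NonCoincident 3 n → S n z = 0) → IsNondegenerateTwoPoint S → IsTranslationInvariant S → IsScaleCovariant Δ S → ∀ L₀ : ℝ → ℕ, ∃ L : ℝ → ℕ, (∀ δ, L₀ δ ≤ L δ) ∧ ∀ n : ℕ, ∃ T : (Fin n → ℝ × ℝ × ℝ) → ℝ, TendstoLocallyUniformlyOn (fun (δ : ℝ) (p : Fin n → ℝ × ℝ × ℝ) => ρ δ ^ n * (let P : Finset (Site 3) := (box 3 (L δ)).filter (fun x => x 1 = 0 ∧ 0 ≤ x 0); let E : Finset (Site 3) := (box 3 (L δ)).filter (fun x => x 1 = 0 ∧ x 0 < 0); let Pr : (↥P → ℤˣ) → (↥E → ℤˣ) → ℝ := fun σ η => isingExpect (zdGraph 3) (box 3 (L δ)) (criticalBeta 3) 0 BoundaryCondition.plus (fun ω => (∏ x : ↥P,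 if ω x.1 = σ x then (1:ℝ) else 0) * ∏ y : ↥E, if ω y.1 = η y then (1:ℝ) else 0); let B : Matrix (↥P → ℤˣ) (↥P → ℤˣ) ℝ := Matrix.of (fun σ' σ => if (∀ x : ↥P, x.1 0 = 0 → σ' x = σ x) then ∑ η : ↥E → ℤˣ, Real.sqrt (Pr σ' η * Pr σ η) else 0); let G : Fin n → Matrix (↥P → ℤˣ) (↥P → ℤˣ) ℝ := fun i => Matrix.diagonal (fun σ => if h : (![⌊(p i).2.1 / δ⌋, 0, ⌊(p i).2.2 / δ⌋] : Site 3) ∈ P then (((σ ⟨_, h⟩ : ℤˣ) : ℤ) : ℝ) else 0); Matrix.trace ((List.ofFn (fun i : Fin n => G i * cfc (fun x : ℝ => x ^ ((p i).1 / (2 * Real.pi))) B)).prod))) T (nhdsWithin (0:ℝ) (Set.Ioi 0)) {p : Fin n → ℝ × ℝ × ℝ | (∀ i, 0 ≤ (p i).1 ∧ 0 < (p i).2.1) ∧ ∑ i, (p i).1 = 2 * Real.pi ∧ (fun i : Fin n => (!₂[(p i).2.1 * Real.cos (∑ j : Fin n, if j < i then (p j).1 else 0), (p i).2.1 * Real.sin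 (∑ j : Fin n, if j < i then (p j).1 else 0), (p i).2.2] : EuclideanSpace ℝ (Fin 3))) ∈ NonCoincident 3 n} := by
  sorry

/-- **Stub I — the modular limit is geometric** (`stub_modularLimitIsGeometric`, lattice
Bisognano–Wichmann proper; THE HEART). Under the crux's hypotheses there is a threshold `L₀ : ℝ → ℕ` such
that for every box growth `L ≥ L₀`, every `n` and every function `T`: if the renormalised interpolated
words of the boxes `Λ_{L(δ)}` converge to `T` locally uniformly on the offset-free wedge domain, then on
that domain `T (φ_i, r_i, z_i)_i = S n ((r_i cos θ_i, r_i sin θ_i, z_i))_i` with `θ_i = Σ_{j<i} φ_j`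
(offset `0`). Why plausibly true: at all anchors `φ_i ∈ (π/2)ℕ` the word equals the box correlator of the
lattice-rotated spins exactly (`QuarterTurnAnchors`, proved) and these converge to `S` once `δ·L₀(δ) → ∞`
(`FiniteVolumeScalingLimit`, proved, + translation invariance of `S`); in between, `−(1/2π) log B` is
predicted to act near the hinge as the rotation generator (BW; lattice evidence GiudiciEtAl2018,
ZhangEtAl2020; CTM = lattice boost, Thacker1986), and for two identical insertions both the word
(`Σ_{jk} λ_j^{1-s}λ_k^s |G_jk|²`) and the conformal target are exponentially convex in the angle
(planner's analytic check). Why it might fail: lattice BW is only approximate off integrability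
(YangDingYan2026) and `log B` need not be local far from the hinge in a `+` box, so a non-geometric
correction could survive `δ → 0`. Size: XL (open problem). Leans on: `QuarterTurnAnchors`,
`FiniteVolumeScalingLimit` (route supports, proved), `TendstoLocallyUniformlyOn.unique`. -/
theorem stub_modularLimitIsGeometric :
    ∀ (ρ : ℝ → ℝ) (Δ : ℝ) (S : CorrFamily 3), (∀ δ ∈ Set.Ioc (0:ℝ) 1, 0 < ρ δ) → 0 < Δ → HasPointwiseScalingLimit (criticalCorr 3) ρ S → (∀ n z, z ∉ NonCoincident 3 n → S n z = 0) → IsNondegenerateTwoPoint S → IsTranslationInvariant S → IsScaleCovariant Δ S → ∃ L₀ : ℝ → ℕ, ∀ L : ℝ → ℕ, (∀ δ, L₀ δ ≤ L δ) → ∀ (n : ℕ) (T : (Fin n → ℝ × ℝ × ℝ) → ℝ), TendstoLocallyUniformlyOn (fun (δ : ℝ) (p : Fin n → ℝ × ℝ × ℝ) => ρ δ ^ n * (let P : Finset (Site 3) := (box 3 (L δ)).filter (fun x => x 1 = 0 ∧ 0 ≤ x 0); let E : Finset (Site 3) := (box 3 (L δ)).filter (fun x => x 1 = 0 ∧ x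 0 < 0); let Pr : (↥P → ℤˣ) → (↥E → ℤˣ) → ℝ := fun σ η => isingExpect (zdGraph 3) (box 3 (L δ)) (criticalBeta 3) 0 BoundaryCondition.plus (fun ω => (∏ x : ↥P, if ω x.1 = σ x then (1:ℝ) else 0) * ∏ y : ↥E, if ω y.1 = η y then (1:ℝ) else 0); let B : Matrix (↥P → ℤˣ) (↥P → ℤˣ) ℝ := Matrix.of (fun σ' σ => if (∀ x : ↥P, x.1 0 = 0 → σ' x = σ x) then ∑ η : ↥E → ℤˣ, Real.sqrt (Pr σ' η * Pr σ η) else 0); let G : Fin n → Matrix (↥P → ℤˣ) (↥P → ℤˣ) ℝ := fun i => Matrix.diagonal (fun σ => if h : (![⌊(p i).2.1 / δ⌋, 0, ⌊(p i).2.2 / δ⌋] : Site 3) ∈ P then (((σ ⟨_, h⟩ : ℤˣ) : ℤ) : ℝ) else 0); Matrix.trace ((List.ofFn (fun i : Fin n => G i * cfc (fun x : ℝ => x ^ ((p i).1 / (2 * Real.pi))) B)).prod))) T (nhdsWithin (0:ℝ) (Set.Ioi 0)) {p : Fin n → ℝ × ℝ × ℝ | (∀ i, 0 ≤ (p i).1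 ∧ 0 < (p i).2.1) ∧ ∑ i, (p i).1 = 2 * Real.pi ∧ (fun i : Fin n => (!₂[(p i).2.1 * Real.cos (∑ j : Fin n, if j < i then (p j).1 else 0), (p i).2.1 * Real.sin (∑ j : Fin n, if j < i then (p j).1 else 0), (p i).2.2] : EuclideanSpace ℝ (Fin 3))) ∈ NonCoincident 3 n} → Set.EqOn T (fun p : Fin n → ℝ × ℝ × ℝ => S n (fun i : Fin n => (!₂[(p i).2.1 * Real.cos (∑ j : Fin n, if j < i then (p j).1 else 0), (p i).2.1 * Real.sin (∑ j : Fin n, if j < i then (p j).1 else 0), (p i).2.2] : EuclideanSpace ℝ (Fin 3)))) {p : Fin n → ℝ × ℝ × ℝ | (∀ i, 0 ≤ (p i).1 ∧ 0 < (p i).2.1) ∧ ∑ i, (p i).1 = 2 * Real.pi ∧ (fun i : Fin n => (!₂[(p i).2.1 * Real.cos (∑ j : Fin n, if j < i then (p j).1 else 0), (p i).2.1 * Real.sin (∑ j : Fin n, if j < i then (p j).1 else 0), (p i).2.2] : EuclideanSpace ℝ (Fin 3))) ∈ NonCoincident 3 n} := by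
  sorry

/-- **Stub A — axial isotropy of the limit** (`stub_axialIsotropy`). Under the crux's hypotheses, for
every `n`, every offset `c` and every `p = (φ_i, r_i, z_i)_i` in the offset-free wedge domain,
`S n ((r_i cos(c+θ_i), r_i sin(c+θ_i), z_i))_i = S n ((r_i cos θ_i, r_i sin θ_i, z_i))_i`,
`θ_i = Σ_{j<i} φ_j`: invariance of `S` under rotations about the hinge (`x₂`-) axis on angle-sorted
configurations off the axis — the exact datum the route's `closes` extracts from the crux for
`AxialRotationUpgrade`. Why plausibly true: isotropy of the critical `ℤ³` scaling limit (universally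
expected; DuminilCopinICM2022 §8.1); it also follows from stubs E ∧ I by cyclicity of the trace plus
permutation symmetry of `S` (M-sized), and from `IsRotationInvariant S` (crux `LimitRotationInvariant` of
route HyperoctahedralRP) by elementary trigonometry. Why it might fail: only if the `ℤ³` limit remembers
the lattice axes (cubic anisotropy surviving at criticality — excluded in every solvable or numerically
studied case, open rigorously). Size: L (open). Leans on: nothing beyond the hypotheses. -/
theorem stub_axialIsotropy :
    ∀ (ρ : ℝ → ℝ) (Δ : ℝ) (S : CorrFamily 3), (∀ δ ∈ Set.Ioc (0:ℝ) 1, 0 < ρ δ) → 0 < Δ → HasPointwiseScalingLimit (criticalCorr 3) ρ S → (∀ n z, z ∉ NonCoincident 3 n → S n z = 0) → IsNondegenerateTwoPoint S → IsTranslationInvariant S → IsScaleCovariant Δ S → ∀ (n : ℕ) (c : ℝ) (p : Fin n → ℝ × ℝ × ℝ), p ∈ {p' : Fin n → ℝ × ℝ × ℝ | (∀ i, 0 ≤ (p' i).1 ∧ 0 < (p' i).2.1) ∧ ∑ i, (p' i).1 = 2 * Real.pi ∧ (fun i : Fin n => (!₂[(p' i).2.1 * Real.cos (∑ j : Fin n,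 if j < i then (p' j).1 else 0), (p' i).2.1 * Real.sin (∑ j : Fin n, if j < i then (p' j).1 else 0), (p' i).2.2] : EuclideanSpace ℝ (Fin 3))) ∈ NonCoincident 3 n} → S n (fun i : Fin n => (!₂[(p i).2.1 * Real.cos (c + ∑ j : Fin n, if j < i then (p j).1 else 0), (p i).2.1 * Real.sin (c + ∑ j : Fin n, if j < i then (p j).1 else 0), (p i).2.2] : EuclideanSpace ℝ (Fin 3))) = S n (fun i : Fin n => (!₂[(p i).2.1 * Real.cos (∑ j : Fin n, if j < i then (p j).1 else 0), (p i).2.1 * Real.sin (∑ j : Fin n, if j < i then (p j).1 else 0), (p i).2.2] : EuclideanSpace ℝ (Fin 3))) := by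
  sorry

/-! ### Composition (sorry-free) -/

/-- **E → I → A → crux (verbatim body)**, proved: take `L₀` from I and `L ≥ L₀`, `T` from E; I identifies
`T` with the offset-`0` target on the wedge domain (`congr_right`); composing with the continuous projection
`(c,p) ↦ p` (`comp`, the crux's domain is its preimage) gives convergence of the crux's `c`-free words on
the crux's domain to the offset-`0` target, and A rewrites that target into the offset-`c` one
(`congr_right`). No uniqueness of limits, no choice beyond the stubs' witnesses. -/
theorem WedgeModularRotation_of_parts
    (hE : ∀ (ρ : ℝ → ℝ) (Δ : ℝ) (S : CorrFamily 3), (∀ δ ∈ Set.Ioc (0:ℝ) 1, 0 < ρ δ) → 0 < Δ → HasPointwiseScalingLimit (criticalCorr 3) ρ S → (∀ n z, z ∉ NonCoincident 3 n → S n z = 0) → IsNondegenerateTwoPoint S → IsTranslationInvariant S → IsScaleCovariant Δ S → ∀ L₀ : ℝ → ℕ, ∃ L : ℝ → ℕ, (∀ δ, L₀ δ ≤ L δ) ∧ ∀ n : ℕ, ∃ T : (Fin n → ℝ × ℝ × ℝ) → ℝ, TendstoLocallyUniformlyOn (fun (δ : ℝ) (p : Fin n → ℝ × ℝ × ℝ)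 => ρ δ ^ n * (let P : Finset (Site 3) := (box 3 (L δ)).filter (fun x => x 1 = 0 ∧ 0 ≤ x 0); let E : Finset (Site 3) := (box 3 (L δ)).filter (fun x => x 1 = 0 ∧ x 0 < 0); let Pr : (↥P → ℤˣ) → (↥E → ℤˣ) → ℝ := fun σ η => isingExpect (zdGraph 3) (box 3 (L δ)) (criticalBeta 3) 0 BoundaryCondition.plus (fun ω => (∏ x : ↥P, if ω x.1 = σ x then (1:ℝ) else 0) * ∏ y : ↥E, if ω y.1 = η y then (1:ℝ) else 0); let B : Matrix (↥P → ℤˣ) (↥P → ℤˣ) ℝ := Matrix.of (fun σ' σ => if (∀ x : ↥P, x.1 0 = 0 → σ' x = σ x) then ∑ η : ↥E → ℤˣ, Real.sqrt (Pr σ' η * Pr σ η) else 0); let G : Fin n → Matrix (↥P → ℤˣ) (↥P → ℤˣ) ℝ := fun i => Matrix.diagonal (fun σ => if h : (![⌊(p i).2.1 / δ⌋, 0, ⌊(p i).2.2 / δ⌋] : Site 3) ∈ P then (((σ ⟨_, h⟩ : ℤˣ) : ℤ) : ℝ) else 0); Matrix.trace ((List.ofFn (fun i : Fin n => G i * cfc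 (fun x : ℝ => x ^ ((p i).1 / (2 * Real.pi))) B)).prod))) T (nhdsWithin (0:ℝ) (Set.Ioi 0)) {p : Fin n → ℝ × ℝ × ℝ | (∀ i, 0 ≤ (p i).1 ∧ 0 < (p i).2.1) ∧ ∑ i, (p i).1 = 2 * Real.pi ∧ (fun i : Fin n => (!₂[(p i).2.1 * Real.cos (∑ j : Fin n, if j < i then (p j).1 else 0), (p i).2.1 * Real.sin (∑ j : Fin n, if j < i then (p j).1 else 0), (p i).2.2] : EuclideanSpace ℝ (Fin 3))) ∈ NonCoincident 3 n})
    (hI : ∀ (ρ : ℝ → ℝ) (Δ : ℝ) (S : CorrFamily 3), (∀ δ ∈ Set.Ioc (0:ℝ) 1, 0 < ρ δ) → 0 < Δ → HasPointwiseScalingLimit (criticalCorr 3) ρ S → (∀ n z, z ∉ NonCoincident 3 n → S n z = 0) → IsNondegenerateTwoPoint S → IsTranslationInvariant S → IsScaleCovariant Δ S → ∃ L₀ : ℝ → ℕ, ∀ L : ℝ → ℕ, (∀ δ, L₀ δ ≤ L δ) → ∀ (n : ℕ) (T : (Fin n → ℝ × ℝ × ℝ) → ℝ), TendstoLocallyUniformlyOn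 (fun (δ : ℝ) (p : Fin n → ℝ × ℝ × ℝ) => ρ δ ^ n * (let P : Finset (Site 3) := (box 3 (L δ)).filter (fun x => x 1 = 0 ∧ 0 ≤ x 0); let E : Finset (Site 3) := (box 3 (L δ)).filter (fun x => x 1 = 0 ∧ x 0 < 0); let Pr : (↥P → ℤˣ) → (↥E → ℤˣ) → ℝ := fun σ η => isingExpect (zdGraph 3) (box 3 (L δ)) (criticalBeta 3) 0 BoundaryCondition.plus (fun ω => (∏ x : ↥P, if ω x.1 = σ x then (1:ℝ) else 0) * ∏ y : ↥E, if ω y.1 = η y then (1:ℝ) else 0); let B : Matrix (↥P → ℤˣ) (↥P → ℤˣ) ℝ := Matrix.of (fun σ' σ => if (∀ x : ↥P, x.1 0 = 0 → σ' x = σ x) then ∑ η : ↥E → ℤˣ, Real.sqrt (Pr σ' η * Pr σ η) else 0); let G : Fin n → Matrix (↥P → ℤˣ) (↥P → ℤˣ) ℝ := fun i => Matrix.diagonal (fun σ => if h : (![⌊(p i).2.1 / δ⌋, 0, ⌊(p i).2.2 / δ⌋] : Site 3) ∈ P then (((σ ⟨_, h⟩ : ℤˣ) : ℤ) : ℝ)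 else 0); Matrix.trace ((List.ofFn (fun i : Fin n => G i * cfc (fun x : ℝ => x ^ ((p i).1 / (2 * Real.pi))) B)).prod))) T (nhdsWithin (0:ℝ) (Set.Ioi 0)) {p : Fin n → ℝ × ℝ × ℝ | (∀ i, 0 ≤ (p i).1 ∧ 0 < (p i).2.1) ∧ ∑ i, (p i).1 = 2 * Real.pi ∧ (fun i : Fin n => (!₂[(p i).2.1 * Real.cos (∑ j : Fin n, if j < i then (p j).1 else 0), (p i).2.1 * Real.sin (∑ j : Fin n, if j < i then (p j).1 else 0), (p i).2.2] : EuclideanSpace ℝ (Fin 3))) ∈ NonCoincident 3 n} → Set.EqOn T (fun p : Fin n → ℝ × ℝ × ℝ => S n (fun i : Fin n => (!₂[(p i).2.1 * Real.cos (∑ j : Fin n, if j < i then (p j).1 else 0), (p i).2.1 * Real.sin (∑ j : Fin n, if j < i then (p j).1 else 0), (p i).2.2] : EuclideanSpace ℝ (Fin 3)))) {p : Fin n → ℝ × ℝ × ℝ | (∀ i, 0 ≤ (p i).1 ∧ 0 < (p i).2.1) ∧ ∑ i, (p i).1 = 2 * Real.pi ∧ (fun i : Fin n => (!₂[(p i).2.1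 * Real.cos (∑ j : Fin n, if j < i then (p j).1 else 0), (p i).2.1 * Real.sin (∑ j : Fin n, if j < i then (p j).1 else 0), (p i).2.2] : EuclideanSpace ℝ (Fin 3))) ∈ NonCoincident 3 n})
    (hA : ∀ (ρ : ℝ → ℝ) (Δ : ℝ) (S : CorrFamily 3), (∀ δ ∈ Set.Ioc (0:ℝ) 1, 0 < ρ δ) → 0 < Δ → HasPointwiseScalingLimit (criticalCorr 3) ρ S → (∀ n z, z ∉ NonCoincident 3 n → S n z = 0) → IsNondegenerateTwoPoint S → IsTranslationInvariant S → IsScaleCovariant Δ S → ∀ (n : ℕ) (c : ℝ) (p : Fin n → ℝ × ℝ × ℝ), p ∈ {p' : Fin n → ℝ × ℝ × ℝ | (∀ i, 0 ≤ (p' i).1 ∧ 0 < (p' i).2.1) ∧ ∑ i, (p' i).1 = 2 * Real.pi ∧ (fun i : Fin n => (!₂[(p' i).2.1 * Real.cos (∑ j : Fin n, if j < i then (p' j).1 else 0), (p' i).2.1 * Real.sin (∑ j : Fin n, if j < i then (p' j).1 else 0), (p' i).2.2] : EuclideanSpace ℝ (Fin 3))) ∈ NonCoincident 3 n} → S n (fun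 i : Fin n => (!₂[(p i).2.1 * Real.cos (c + ∑ j : Fin n, if j < i then (p j).1 else 0), (p i).2.1 * Real.sin (c + ∑ j : Fin n, if j < i then (p j).1 else 0), (p i).2.2] : EuclideanSpace ℝ (Fin 3))) = S n (fun i : Fin n => (!₂[(p i).2.1 * Real.cos (∑ j : Fin n, if j < i then (p j).1 else 0), (p i).2.1 * Real.sin (∑ j : Fin n, if j < i then (p j).1 else 0), (p i).2.2] : EuclideanSpace ℝ (Fin 3)))) :
    ∀ (ρ : ℝ → ℝ) (Δ : ℝ) (S : CorrFamily 3), (∀ δ ∈ Set.Ioc (0:ℝ) 1, 0 < ρ δ) → 0 < Δ → HasPointwiseScalingLimit (criticalCorr 3) ρ S → (∀ n z, z ∉ NonCoincident 3 n → S n z = 0) → IsNondegenerateTwoPoint S → IsTranslationInvariant S → IsScaleCovariant Δ S → ∃ L : ℝ → ℕ, ∀ n : ℕ, TendstoLocallyUniformlyOn (fun (δ : ℝ) (q : ℝ × (Fin n → ℝ × ℝ × ℝ)) => ρ δ ^ n * (let P : Finset (Site 3) := (box 3 (L δ)).filter (fun x => x 1 = 0 ∧ 0 ≤ x 0); let E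 : Finset (Site 3) := (box 3 (L δ)).filter (fun x => x 1 = 0 ∧ x 0 < 0); let Pr : (↥P → ℤˣ) → (↥E → ℤˣ) → ℝ := fun σ η => isingExpect (zdGraph 3) (box 3 (L δ)) (criticalBeta 3) 0 BoundaryCondition.plus (fun ω => (∏ x : ↥P, if ω x.1 = σ x then (1:ℝ) else 0) * ∏ y : ↥E, if ω y.1 = η y then (1:ℝ) else 0); let B : Matrix (↥P → ℤˣ) (↥P → ℤˣ) ℝ := Matrix.of (fun σ' σ => if (∀ x : ↥P, x.1 0 = 0 → σ' x = σ x) then ∑ η : ↥E → ℤˣ, Real.sqrt (Pr σ' η * Pr σ η) else 0); let G : Fin n → Matrix (↥P → ℤˣ) (↥P → ℤˣ) ℝ := fun i => Matrix.diagonal (fun σ => if h : (![⌊(q.2 i).2.1 / δ⌋, 0, ⌊(q.2 i).2.2 / δ⌋] : Site 3) ∈ P then (((σ ⟨_, h⟩ : ℤˣ) : ℤ) : ℝ) else 0); Matrix.trace ((List.ofFn (fun i : Fin n => G i * cfc (fun x : ℝ => x ^ ((q.2 i).1 / (2 * Real.pi))) B)).prod))) (fun q => S n (fun i : Fin n =>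 (!₂[(q.2 i).2.1 * Real.cos (q.1 + ∑ j : Fin n, if j < i then (q.2 j).1 else 0), (q.2 i).2.1 * Real.sin (q.1 + ∑ j : Fin n, if j < i then (q.2 j).1 else 0), (q.2 i).2.2] : EuclideanSpace ℝ (Fin 3)))) (nhdsWithin (0:ℝ) (Set.Ioi 0)) {q : ℝ × (Fin n → ℝ × ℝ × ℝ) | (∀ i, 0 ≤ (q.2 i).1 ∧ 0 < (q.2 i).2.1) ∧ ∑ i, (q.2 i).1 = 2 * Real.pi ∧ (fun i : Fin n => (!₂[(q.2 i).2.1 * Real.cos (∑ j : Fin n, if j < i then (q.2 j).1 else 0), (q.2 i).2.1 * Real.sin (∑ j : Fin n, if j < i then (q.2 j).1 else 0), (q.2 i).2.2] : EuclideanSpace ℝ (Fin 3))) ∈ NonCoincident 3 n} := by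
  intro ρ Δ S hρ hΔ hlim hnorm hnd htr hsc
  obtain ⟨L₀, hL₀⟩ := hI ρ Δ S hρ hΔ hlim hnorm hnd htr hsc
  obtain ⟨L, hLL, hL⟩ := hE ρ Δ S hρ hΔ hlim hnorm hnd htr hsc L₀
  refine ⟨L, fun n => ?_⟩
  obtain ⟨T, hT⟩ := hL n
  have hid := hL₀ L hLL n T hT
  have h2 : TendstoLocallyUniformlyOn (fun (δ : ℝ) (q : ℝ × (Fin n → ℝ × ℝ × ℝ)) => ρ δ ^ n * (let P : Finset (Site 3) := (box 3 (L δ)).filter (fun x => x 1 = 0 ∧ 0 ≤ x 0); let E : Finset (Site 3) := (box 3 (L δ)).filter (fun x => x 1 = 0 ∧ x 0 < 0); let Pr : (↥P → ℤˣ) → (↥E → ℤˣ) → ℝ := fun σ η => isingExpect (zdGraph 3) (box 3 (L δ)) (criticalBeta 3) 0 BoundaryCondition.plus (fun ω => (∏ x : ↥P, if ω x.1 = σ x then (1:ℝ) else 0) * ∏ y : ↥E, if ω y.1 = η y then (1:ℝ) else 0); let B : Matrix (↥P → ℤˣ) (↥P → ℤˣ) ℝ := Matrix.of (fun σ' σ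 => if (∀ x : ↥P, x.1 0 = 0 → σ' x = σ x) then ∑ η : ↥E → ℤˣ, Real.sqrt (Pr σ' η * Pr σ η) else 0); let G : Fin n → Matrix (↥P → ℤˣ) (↥P → ℤˣ) ℝ := fun i => Matrix.diagonal (fun σ => if h : (![⌊(q.2 i).2.1 / δ⌋, 0, ⌊(q.2 i).2.2 / δ⌋] : Site 3) ∈ P then (((σ ⟨_, h⟩ : ℤˣ) : ℤ) : ℝ) else 0); Matrix.trace ((List.ofFn (fun i : Fin n => G i * cfc (fun x : ℝ => x ^ ((q.2 i).1 / (2 * Real.pi))) B)).prod))) (fun q => S n (fun i : Fin n => (!₂[(q.2 i).2.1 * Real.cos (∑ j : Fin n, if j < i then (q.2 j).1 else 0), (q.2 i).2.1 * Real.sin (∑ j : Fin n, if j < i then (q.2 j).1 else 0), (q.2 i).2.2] : EuclideanSpace ℝ (Fin 3)))) (nhdsWithin (0:ℝ) (Set.Ioi 0)) {q : ℝ × (Fin n → ℝ × ℝ × ℝ) | (∀ i, 0 ≤ (q.2 i).1 ∧ 0 < (q.2 i).2.1) ∧ ∑ i, (q.2 i).1 = 2 * Real.pi ∧ (fun i :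 Fin n => (!₂[(q.2 i).2.1 * Real.cos (∑ j : Fin n, if j < i then (q.2 j).1 else 0), (q.2 i).2.1 * Real.sin (∑ j : Fin n, if j < i then (q.2 j).1 else 0), (q.2 i).2.2] : EuclideanSpace ℝ (Fin 3))) ∈ NonCoincident 3 n} :=
    (hT.congr_right hid).comp (fun q : ℝ × (Fin n → ℝ × ℝ × ℝ) => q.2) (fun q hq => hq)
      continuous_snd.continuousOn
  refine h2.congr_right ?_
  intro q hq
  exact (hA ρ Δ S hρ hΔ hlim hnorm hnd htr hsc n q.1 q.2 hq).symm

/-- **The registered skeleton**: the crux decl of item stmt-CriticalPhenomena-6493, BY NAME, from the three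
declared stubs through the sorry-free `WedgeModularRotation_of_parts`. Axiom closure
`{propext, Classical.choice, Quot.sound} ∪ {sorryAx via stub_modularWordsConverge,
stub_modularLimitIsGeometric, stub_axialIsotropy}` until the stubs are proved. -/
theorem WedgeModularRotation_of :
    Summit.CriticalPhenomena.Ising3DConformalLimit.Theses.ModularQuarterTurn.WedgeModularRotation :=
  WedgeModularRotation_of_parts stub_modularWordsConverge stub_modularLimitIsGeometric stub_axialIsotropy

end Summit.CriticalPhenomena.Ising3DConformalLimit.Cruxes.WedgeModularRotation.Birth
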